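import Literature.NumberTheory.GaloisRepresentations.PotentialDiagonalizabilityCriteriaProofs
import Mathlib.RingTheory.DiscreteValuationRing.TFAE
import Mathlib.RingTheory.Valuation.ValuationRing
import HarnessLib

/-!
# `𝒪_E` is a complete discrete valuation ring for `E/ℚ_p` finite inside `ℚ̄_p` (proofs only)

Topic `NumberTheory/GaloisRepresentations` (theorems and one auxiliary definition with body — the
embedding `ℤ_p → 𝒪_E`; no named fact). For a subfield `ℚ_p ⊆ E ⊆ ℚ̄_p = PadicAlgCl p` the tree's
coefficient ring `padicCoeffRing E = {x ∈ E : ‖x‖ ≤ 1}` (`PotentialDiagonalizability.lean`) is known to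
be a complete Noetherian local ring for `E/ℚ_p` finite (`isLocalRing_padicCoeffRing`,
`isNoetherianRing_padicCoeffRing`, `isAdicComplete_padicCoeffRing`). Here:

* `valuationRing_padicCoeffRing`: `𝒪_E` is a valuation ring (of two elements, the one of smaller
  norm is a multiple of the other), whence for `E/ℚ_p` finite — a Noetherian local domain which is
  not a field — **`𝒪_E` is a discrete valuation ring** (`isDiscreteValuationRing_padicCoeffRing`,
  Mathlib's `IsDiscreteValuationRing.TFAE`), in particular a principal ideal domain
  (`isPrincipalIdealRing_padicCoeffRing`);
* `padicIntToCoeffRing E : ℤ_p →+* 𝒪_E` (the structure map), its compatibility with the norm and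
  with the residue maps (`residue_padicIntToCoeffRing`: `𝒪_E → k_E` restricted to `ℤ_p` is
  `ℤ_p → 𝔽_p → k_E`, `charP_residueField_padicCoeffRing`);
* `Padic.norm_le_one_of_pow_mul_norm_le_one`: if `rᵏ‖u‖ ≤ 1` with `rᵉ = p⁻¹`, `k < e`, `u ∈ ℚ_p`,
  then `‖u‖ ≤ 1` (an element of `ℚ_p` which becomes integral after multiplication by `πᵏ`,
  `πᵉ = p`, `k < e`, is integral: `e ∤ k`).

These are the ring-theoretic inputs of the semistable-extension step (over `ℚ_p(p^{1/12})`) in the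
finite-height route to the integrality of the Manin constant at the additive primes
(`Literature/NumberTheory/EllipticCurves/NeronIsogenyScaling.lean`).

## References

* J.-P. Serre, *Local Fields* (1979), II §1–§2 (the ring of integers of a finite extension of `ℚ_p`
  is a complete discrete valuation ring). [folklore]
* S. Bosch, U. Güntzer, R. Remmert, *Non-Archimedean Analysis* (1984), 3.2.1. [folklore]
-/

noncomputable section

open scoped Classical

namespace Literature.NumberTheory.GaloisRepresentations

open IsLocalRing

variable {p : ℕ} [Fact p.Prime]

/-! ### Valuation ring, not a field, discrete valuation ring -/

/-- `𝒪_E` is a domain (a subring of the field `E`). [folklore] -/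
instance isDomain_padicCoeffRing (E : IntermediateField ℚ_[p] (PadicAlgCl p)) :
    IsDomain (padicCoeffRing E) := inferInstance

/-- **Of two elements of `𝒪_E` the one of smaller norm is a multiple of the other** (`c = b/a` has
norm `≤ 1`). [folklore] -/
theorem preValuationRing_padicCoeffRing (E : IntermediateField ℚ_[p] (PadicAlgCl p)) :
    PreValuationRing (padicCoeffRing E) := by
  refine ⟨fun a b ↦ ?_⟩
  rcases le_total ‖((b : E) : PadicAlgCl p)‖ ‖((a : E) : PadicAlgCl p)‖ with hba | hab
  · -- `b = a · (b/a)`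
    by_cases ha : (a : E) = 0
    · have hb : (b : E) = 0 := by
        rw [ha] at hba
        simpa using hba
      refine ⟨0, Or.inl ?_⟩
      apply Subtype.ext
      push_cast
      rw [hb, mul_zero]
    · have hc : (b : E) / (a : E) ∈ padicCoeffRing E := by
        rw [mem_padicCoeffRing_iff]
        push_cast
        rw [norm_div, div_le_one (norm_pos_iff.mpr (by exact_mod_cast ha))]
        exact hba
      refine ⟨⟨_, hc⟩, Or.inl ?_⟩
      apply Subtype.ext
      push_cast
      rw [mul_div_cancel₀ _ ha]
  · by_cases hb : (b : E) = 0
    · have ha : (a : E) = 0 := by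
        rw [hb] at hab
        simpa using hab
      refine ⟨0, Or.inr ?_⟩
      apply Subtype.ext
      push_cast
      rw [ha, mul_zero]
    · have hc : (a : E) / (b : E) ∈ padicCoeffRing E := by
        rw [mem_padicCoeffRing_iff]
        push_cast
        rw [norm_div, div_le_one (norm_pos_iff.mpr (by exact_mod_cast hb))]
        exact hab
      refine ⟨⟨_, hc⟩, Or.inr ?_⟩
      apply Subtype.ext
      push_cast
      rw [mul_div_cancel₀ _ hb]

/-- **`𝒪_E` is a valuation ring.** [folklore] -/
theorem valuationRing_padicCoeffRing (E : IntermediateField ℚ_[p] (PadicAlgCl p)) :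
    ValuationRing (padicCoeffRing E) := by
  haveI := preValuationRing_padicCoeffRing E
  exact ⟨⟩

/-- `p ∈ 𝒪_E` is nonzero and not a unit, so **`𝒪_E` is not a field**. [folklore] -/
theorem not_isField_padicCoeffRing (E : IntermediateField ℚ_[p] (PadicAlgCl p)) :
    ¬ IsField (padicCoeffRing E) := by
  letI := isLocalRing_padicCoeffRing E
  intro hF
  have hmax : maximalIdeal (padicCoeffRing E) = ⊥ := (isField_iff_maximalIdeal_eq).mp hF
  have hp : ((p : ℕ) : padicCoeffRing E) ∈ maximalIdeal (padicCoeffRing E) := by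
    rw [mem_maximalIdeal_padicCoeffRing_iff]
    push_cast
    exact norm_natCast_padicAlgCl_lt_one
  rw [hmax, Ideal.mem_bot] at hp
  have h0 : ((p : ℕ) : PadicAlgCl p) = 0 := by
    have := congrArg (fun z : padicCoeffRing E ↦ ((z : E) : PadicAlgCl p)) hp
    push_cast at this
    exact this
  exact (Fact.out : p.Prime).ne_zero (by exact_mod_cast h0)

/-- **`𝒪_E` is a discrete valuation ring** for `E/ℚ_p` finite: a Noetherian local domain, not a
field, which is a valuation ring (Mathlib's `IsDiscreteValuationRing.TFAE`).
Ref: Serre, *Local Fields*, II §2 Prop. 3. [folklore] -/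
theorem isDiscreteValuationRing_padicCoeffRing (E : IntermediateField ℚ_[p] (PadicAlgCl p))
    [FiniteDimensional ℚ_[p] E] :
    letI := isLocalRing_padicCoeffRing E
    IsDiscreteValuationRing (padicCoeffRing E) := by
  letI := isLocalRing_padicCoeffRing E
  haveI := isNoetherianRing_padicCoeffRing E
  exact ((IsDiscreteValuationRing.TFAE (padicCoeffRing E) (not_isField_padicCoeffRing E)).out 0 1).mpr
    (valuationRing_padicCoeffRing E)

/-- In particular `𝒪_E` is a principal ideal domain for `E/ℚ_p` finite. [folklore] -/
theorem isPrincipalIdealRing_padicCoeffRing (E : IntermediateField ℚ_[p] (PadicAlgCl p))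
    [FiniteDimensional ℚ_[p] E] : IsPrincipalIdealRing (padicCoeffRing E) := by
  letI := isLocalRing_padicCoeffRing E
  haveI := isDiscreteValuationRing_padicCoeffRing E
  infer_instance

/-! ### The structure map `ℤ_p → 𝒪_E` and the residue fields -/

/-- **The structure map `ℤ_p → 𝒪_E`** (`ℤ_p ⊆ ℚ_p ⊆ E`, norms are preserved). [folklore] -/
def padicIntToCoeffRing (E : IntermediateField ℚ_[p] (PadicAlgCl p)) :
    ℤ_[p] →+* padicCoeffRing E :=
  ((algebraMap ℚ_[p] E).comp (PadicInt.Coe.ringHom (p := p))).codRestrict (padicCoeffRing E)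
    fun x ↦ by
      rw [mem_padicCoeffRing_iff, RingHom.comp_apply, IntermediateField.coe_algebraMap_apply]
      change ‖((x : ℚ_[p]) : PadicAlgCl p)‖ ≤ 1
      rw [PadicAlgCl.norm_extends]
      exact x.2

/-- Unfolding: `ℤ_p → 𝒪_E → E` is `ℤ_p ⊆ ℚ_p → E`. [folklore] -/
@[simp] theorem coe_padicIntToCoeffRing (E : IntermediateField ℚ_[p] (PadicAlgCl p)) (x : ℤ_[p]) :
    ((padicIntToCoeffRing E x : padicCoeffRing E) : E) = algebraMap ℚ_[p] E (x : ℚ_[p]) := rfl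

/-- `ℤ_p → 𝒪_E → E → ℚ̄_p` is `ℤ_p ⊆ ℚ_p ⊆ ℚ̄_p`. [folklore] -/
theorem coe_coe_padicIntToCoeffRing (E : IntermediateField ℚ_[p] (PadicAlgCl p)) (x : ℤ_[p]) :
    (((padicIntToCoeffRing E x : padicCoeffRing E) : E) : PadicAlgCl p) = ((x : ℚ_[p]) : PadicAlgCl p) := by
  rw [coe_padicIntToCoeffRing, IntermediateField.coe_algebraMap_apply]

/-- The structure map preserves norms. [folklore] -/
theorem norm_padicIntToCoeffRing (E : IntermediateField ℚ_[p] (PadicAlgCl p)) (x : ℤ_[p]) :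
    ‖(((padicIntToCoeffRing E x : padicCoeffRing E) : E) : PadicAlgCl p)‖ = ‖x‖ := by
  rw [coe_coe_padicIntToCoeffRing, PadicAlgCl.norm_extends]
  rfl

/-- The structure map is injective. [folklore] -/
theorem padicIntToCoeffRing_injective (E : IntermediateField ℚ_[p] (PadicAlgCl p)) :
    Function.Injective (padicIntToCoeffRing E) := by
  intro x y hxy
  have h := congrArg (fun z : padicCoeffRing E ↦ ((z : E) : PadicAlgCl p)) hxy
  simp only [coe_coe_padicIntToCoeffRing] at h
  have h' : (x : ℚ_[p]) = (y : ℚ_[p]) := (algebraMap ℚ_[p] (PadicAlgCl p)).injective h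
  exact PadicInt.ext h'

/-- The maximal ideal of `ℤ_p` maps into the maximal ideal of `𝒪_E`. [folklore] -/
theorem padicIntToCoeffRing_mem_maximalIdeal (E : IntermediateField ℚ_[p] (PadicAlgCl p))
    {x : ℤ_[p]} (hx : x ∈ maximalIdeal ℤ_[p]) :
    letI := isLocalRing_padicCoeffRing E
    padicIntToCoeffRing E x ∈ maximalIdeal (padicCoeffRing E) := by
  letI := isLocalRing_padicCoeffRing E
  rw [mem_maximalIdeal_padicCoeffRing_iff, norm_padicIntToCoeffRing]
  exact PadicInt.mem_nonunits.mp ((IsLocalRing.mem_maximalIdeal _).mp hx)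

/-- `p` lies in the maximal ideal of `𝒪_E`. [folklore] -/
theorem natCast_mem_maximalIdeal_padicCoeffRing (E : IntermediateField ℚ_[p] (PadicAlgCl p)) :
    letI := isLocalRing_padicCoeffRing E
    ((p : ℕ) : padicCoeffRing E) ∈ maximalIdeal (padicCoeffRing E) := by
  letI := isLocalRing_padicCoeffRing E
  rw [mem_maximalIdeal_padicCoeffRing_iff]
  push_cast
  exact norm_natCast_padicAlgCl_lt_one

/-- **The residue field `k_E` of `𝒪_E` has characteristic `p`.** [folklore] -/
theorem charP_residueField_padicCoeffRing (E : IntermediateField ℚ_[p] (PadicAlgCl p)) :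
    letI := isLocalRing_padicCoeffRing E
    CharP (ResidueField (padicCoeffRing E)) p := by
  letI := isLocalRing_padicCoeffRing E
  refine (CharP.charP_iff_prime_eq_zero Fact.out).mpr ?_
  rw [← map_natCast (residue (padicCoeffRing E)) p, residue_eq_zero_iff]
  exact natCast_mem_maximalIdeal_padicCoeffRing E

/-- **Compatibility of the residue maps**: for `x ∈ ℤ_p`, the residue class in `k_E` of its image in
`𝒪_E` is the image of `x mod p ∈ 𝔽_p` under `𝔽_p → k_E`. [folklore] -/
theorem residue_padicIntToCoeffRing (E : IntermediateField ℚ_[p] (PadicAlgCl p)) (x : ℤ_[p]) :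
    letI := isLocalRing_padicCoeffRing E
    letI := charP_residueField_padicCoeffRing E
    residue (padicCoeffRing E) (padicIntToCoeffRing E x) =
      ZMod.castHom (dvd_refl p) (ResidueField (padicCoeffRing E)) (PadicInt.toZMod x) := by
  letI := isLocalRing_padicCoeffRing E
  letI := charP_residueField_padicCoeffRing E
  -- `x = (x mod p) + m`, `m ∈ 𝔪_{ℤ_p}`
  have hm : x - (ZMod.cast (PadicInt.toZMod x) : ℤ_[p]) ∈ maximalIdeal ℤ_[p] := PadicInt.toZMod_spec x
  have h1 : residue (padicCoeffRing E) (padicIntToCoeffRing E (x - (ZMod.cast (PadicInt.toZMod x) : ℤ_[p]))) = 0 :=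
    (residue_eq_zero_iff _).mpr (padicIntToCoeffRing_mem_maximalIdeal E hm)
  rw [map_sub, map_sub, sub_eq_zero] at h1
  rw [h1]
  -- both sides are the image of the natural number `(x mod p).val`
  have hc : (ZMod.cast (PadicInt.toZMod x) : ℤ_[p]) = ((PadicInt.toZMod x).val : ℤ_[p]) := by
    rw [ZMod.cast_eq_val]
  rw [hc, map_natCast, map_natCast]
  conv_rhs => rw [← ZMod.natCast_zmod_val (PadicInt.toZMod x)]
  rw [map_natCast]

/-- Units of `ℤ_p` map to units of `𝒪_E`; elements of `𝒪_E` coming from `ℤ_p` with nonzero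
reduction mod `p` are units. [folklore] -/
theorem isUnit_padicIntToCoeffRing_of_toZMod_ne_zero (E : IntermediateField ℚ_[p] (PadicAlgCl p))
    {x : ℤ_[p]} (hx : PadicInt.toZMod x ≠ 0) : IsUnit (padicIntToCoeffRing E x) := by
  have hu : IsUnit x := by
    by_contra h
    apply hx
    have hmem : x ∈ maximalIdeal ℤ_[p] := (IsLocalRing.mem_maximalIdeal _).mpr h
    rw [← PadicInt.ker_toZMod] at hmem
    exact hmem
  exact hu.map _

/-! ### An element of `ℚ_p` which is integral after multiplication by `πᵏ`, `πᵉ = p`, `k < e` -/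

/-- **If `rᵏ · ‖u‖ ≤ 1` with `rᵉ = p⁻¹`, `k < e` and `u ∈ ℚ_p`, then `‖u‖ ≤ 1`**: the norm of a
nonzero `p`-adic number is an INTEGRAL power of `p`, while `r⁻ᵏ = p^{k/e}` with `0 ≤ k/e < 1`.
(With `r = ‖π‖`, `πᵉ = p`: an element of `ℚ_p` lying in `π⁻ᵏ 𝒪_{ℚ_p(π)}` lies in `ℤ_p`.) [folklore] -/
theorem _root_.Padic.norm_le_one_of_pow_mul_norm_le_one {u : ℚ_[p]} {r : ℝ} {e k : ℕ}
    (hr0 : 0 ≤ r) (hr : r ^ e = (p : ℝ)⁻¹) (hk : k < e) (h : r ^ k * ‖u‖ ≤ 1) : ‖u‖ ≤ 1 := by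
  have hp1 : (1 : ℝ) < p := by exact_mod_cast (Fact.out : p.Prime).one_lt
  have hp0 : (0 : ℝ) < p := by positivity
  by_contra hu
  rw [not_le] at hu
  have hu0 : u ≠ 0 := fun h0 ↦ by rw [h0, norm_zero] at hu; exact absurd hu (by norm_num)
  -- `‖u‖ = p^m` with `m ≥ 1`
  have hnorm := Padic.norm_eq_zpow_neg_valuation hu0
  have hm : 1 ≤ -u.valuation := by
    by_contra hm
    rw [not_le] at hm
    have : ‖u‖ ≤ 1 := by
      rw [hnorm]
      exact zpow_le_one_of_nonpos₀ hp1.le (by omega)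
    exact absurd hu (not_lt.mpr this)
  have hpu : (p : ℝ) ≤ ‖u‖ := by
    rw [hnorm]
    calc (p : ℝ) = (p : ℝ) ^ (1 : ℤ) := (zpow_one _).symm
      _ ≤ (p : ℝ) ^ (-u.valuation) := zpow_le_zpow_right₀ hp1.le hm
  -- `1 ≥ (rᵏ‖u‖)ᵉ = p^{-k} ‖u‖ᵉ ≥ p^{-k} pᵉ = p^{e-k} > 1`
  have hre : 0 < r := by
    rcases hr0.lt_or_eq with h' | h'
    · exact h'
    · exfalso
      rw [← h'] at hr
      rcases Nat.eq_zero_or_pos e with he | he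
      · omega
      · rw [zero_pow he.ne'] at hr
        exact absurd hr.symm (inv_ne_zero hp0.ne')
  have h1 : (r ^ k * ‖u‖) ^ e ≤ 1 := pow_le_one₀ (by positivity) h
  have h2 : (r ^ k * ‖u‖) ^ e = (p : ℝ)⁻¹ ^ k * ‖u‖ ^ e := by
    rw [mul_pow, ← pow_mul, mul_comm k e, pow_mul, hr]
  rw [h2] at h1
  have h3 : (p : ℝ)⁻¹ ^ k * (p : ℝ) ^ e ≤ (p : ℝ)⁻¹ ^ k * ‖u‖ ^ e := by
    gcongr
  have h4 : (p : ℝ)⁻¹ ^ k * (p : ℝ) ^ e = (p : ℝ) ^ (e - k) := by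
    rw [inv_pow, ← div_eq_inv_mul, div_eq_iff (by positivity), ← pow_add, Nat.sub_add_cancel hk.le]
  have h5 : (1 : ℝ) < (p : ℝ) ^ (e - k) := one_lt_pow₀ hp1 (by omega)
  linarith

end Literature.NumberTheory.GaloisRepresentations
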